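import Summits.CriticalPhenomena.PercolationContinuityZ3.Theorems.PercNearOneGluingNoHeavyLowerTailAntitheticIndepCopies
import Summits.CriticalPhenomena.PercolationContinuityZ3.Theorems.PercNearOneGluingNoHeavyLowerTailAntitheticTwoStageFan
import HarnessLib

/-!
# `NoHeavyLowerTail` (stmt-CriticalPhenomena-4575) — antithetic cluster pairs: THEOREM R (every rooted cone is R-associated),
# part 1: fibres of the blue cluster of `z`, and BHK Thm 1.3 for VERTEX clusters in the uniform language
# (HOME/THEOREM-R.md, prim-hp-2 gen 60)

Support file (`--supports stmt-CriticalPhenomena-4575`, hull-port prover `prim-hp-2`, gen 60).  No definitions, no named facts, no sorries;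
standard axioms.  VERTEX version, setting of …AntitheticTwoStageGraph: a configuration `T ⊆ Sym2 V` is a red/blue colouring of the pairs
(`T` red, `Tᶜ` blue); for an edge set `E` and source `s` the red cluster is `openCluster (T ∩ E) s`, the blue cluster `openCluster (Tᶜ ∩ E) s`
(vertex clusters); sums over all `T` are the uniform law.

THEOREM R (HOME/THEOREM-R.md): if every vertex of the blue cluster of `z` is adjacent to `s` whenever that cluster misses `s` (every rooted
cone `s * H₂`, any `H₂`), then the law of the pair (red cluster, blue cluster) of `s` CONDITIONED on `z ∉ blue cluster` is positively associated
for the twisted order — hypothesis (H2) = `hR` of `Antithetic.TwoStage.change_nonneg` (THEOREM 2H).  The proof is van den Berg–Häggström–Kahn's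
proof of their Thm 1.5 run for the pair: condition on the blue vertex cluster `S` of `z`; on that fibre the pair is the pair of the configuration
with every pair meeting `S` recoloured red (this file: `Cone.fibre_red`, `Cone.fibre_blue`, cylinder property `Cone.fibre_iff`), a monotone
image of the fresh uniform variables (Harris), increasing in `S`; and the law of `S` given `s ∉ S` is positively associated by BHK Thm 1.3 —
PROVED in the tree (`BHK2006.core` / `IndepCopies.bhk_pa`) — transported here to vertex clusters of percolation on `E` in the uniform language
(`Cone.bhk_vertex`, via the change of weights `Cone.sum_weight_indicator`).  Part 2 (…AntitheticTwoStageCone) assembles THEOREM R and the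
corollaries with THEOREM 2H.
[cite: VandenbergHaggstromKahn2005, Thm. 1.3 (p. 6), Thm. 1.5 (pp. 7–8, proof), §1 p. 6 ("Harris' inequality")]
-/

noncomputable section

namespace Summit.CriticalPhenomena.PercolationContinuityZ3.Theorems

open Literature.Probability.Percolation Literature.Probability.Percolation.BHK2006 DecisionTree
open scoped Classical

namespace Antithetic

namespace TwoStage

namespace Cone

/-! ### Uniform-law tools on the Boolean lattice `Set ι` -/

section Lattice

variable {ι : Type*} [Fintype ι]

/-- Harris–FKG for the counting weight and two monotone real functions of any sign: `(Σ f)(Σ g) ≤ |Set ι| Σ f g`.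
[cite: VandenbergHaggstromKahn2005, §1 p. 6 ("Harris' inequality")] -/
theorem harris_real {f g : Set ι → ℝ} (hf : Monotone f) (hg : Monotone g) :
    (∑ T, f T) * (∑ T, g T) ≤ (Fintype.card (Set ι) : ℝ) * ∑ T, f T * g T := by
  have h := Fan.fkg_real (fun _ : Set ι => (1 : ℝ)) f g (fun _ => zero_le_one) hf hg (fun a b => by simp)
  simpa only [one_mul, Finset.sum_const, Finset.card_univ, nsmul_eq_mul, mul_one] using h

/-- **Uniform block Fubini**: for a block `A`, summing a function of `(T ∩ A, T' \ A)` over two independent uniform configurations is `|Set ι|`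
times the sum of the same function of `(T ∩ A, T \ A)` over one. [folklore] -/
theorem sum_block (A : Set ι) (Φ : Set ι → Set ι → ℝ) :
    ∑ T, ∑ T', Φ (T ∩ A) (T' \ A) = (Fintype.card (Set ι) : ℝ) * ∑ T, Φ (T ∩ A) (T \ A) := by
  have h1 : ∑ T, ∑ T', Φ (T ∩ A) (T' \ A) = ∑ p : Set ι × Set ι, Φ (p.1 ∩ A) (p.2 \ A) :=
    (Fintype.sum_prod_type' (fun T T' => Φ (T ∩ A) (T' \ A))).symm
  have h2 : ∑ p : Set ι × Set ι, Φ (p.1 ∩ A) (p.2 \ A) = ∑ q : Set ι × Set ι, Φ (q.2 ∩ A) (q.2 \ A) := by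
    refine Fintype.sum_bijective _ (swap_involutive A).bijective _ _ (fun p => ?_)
    show Φ (p.1 ∩ A) (p.2 \ A) = Φ ((A.ite p.1 p.2) ∩ A) ((A.ite p.1 p.2) \ A)
    rw [ite_inter_eq, ite_diff_eq]
  rw [h1, h2, Fintype.sum_prod_type]
  simp only [Finset.sum_const, Finset.card_univ, nsmul_eq_mul]

/-- The product weight with all parameters `½` is the constant `2^{-|ι|}`. [folklore] -/
theorem weight_half (T : Set ι) : weight (fun _ : ι => (1 / 2 : ℝ)) T = (1 / 2) ^ Fintype.card ι := by
  unfold weight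
  rw [← Finset.card_univ, ← Finset.prod_const]
  exact Finset.prod_congr rfl fun e _ => by split_ifs <;> norm_num

/-- Swapping the coordinates outside `A` between two configurations preserves the product of their weights under two parameter vectors
that agree outside `A`. [folklore] -/
theorem weight_swap₂ (w₁ w₂ : ι → ℝ) (A : Set ι) (hA : ∀ e, e ∉ A → w₁ e = w₂ e) (a b : Set ι) :
    weight w₁ a * weight w₂ b = weight w₁ (A.ite a b) * weight w₂ (A.ite b a) := by
  unfold weight
  rw [← Finset.prod_mul_distrib, ← Finset.prod_mul_distrib]
  refine Finset.prod_congr rfl fun e _ => ?_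
  by_cases heA : e ∈ A
  · by_cases ha : e ∈ a <;> by_cases hb : e ∈ b <;> simp [Set.ite, heA, ha, hb]
  · rw [hA e heA]
    by_cases ha : e ∈ a <;> by_cases hb : e ∈ b <;> simp [Set.ite, heA, ha, hb, mul_comm]

/-- The indicator weight (`½` on `E`, `0` off `E`) is supported on configurations inside `E`. [folklore] -/
theorem subset_of_weight_indicator_ne_zero {E ω : Set ι}
    (h : weight (fun e => if e ∈ E then (1 / 2 : ℝ) else 0) ω ≠ 0) : ω ⊆ E := by
  intro e he
  by_contra heE
  apply h
  unfold weight
  exact Finset.prod_eq_zero (Finset.mem_univ e) (by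
    rw [if_pos he]
    show (if e ∈ E then (1 / 2 : ℝ) else 0) = 0
    rw [if_neg heE])

/-- **Change of weights**: the expectation of `g` under bond percolation with probability `½` on `E` (and `0` off `E`) is the uniform average of
`g (T ∩ E)`.  [folklore] -/
theorem sum_weight_indicator (E : Set ι) (g : Set ι → ℝ) :
    ∑ ω, weight (fun e => if e ∈ E then (1 / 2 : ℝ) else 0) ω * g ω =
      (1 / 2 : ℝ) ^ Fintype.card ι * ∑ T, g (T ∩ E) := by
  set wE : ι → ℝ := fun e => if e ∈ E then (1 / 2 : ℝ) else 0 with hwE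
  set u : ι → ℝ := fun _ => (1 / 2 : ℝ) with hu
  -- (a) on the support `ω ⊆ E`, so `g ω = g (ω ∩ E)`
  have ha : ∑ ω, weight wE ω * g ω = ∑ ω, weight wE ω * g (ω ∩ E) := by
    refine Finset.sum_congr rfl fun ω _ => ?_
    by_cases h0 : weight wE ω = 0
    · rw [h0, zero_mul, zero_mul]
    · rw [Set.inter_eq_left.2 (subset_of_weight_indicator_ne_zero h0)]
  -- (b) swap the `E`-coordinates between a uniform configuration and a `wE`-configuration
  have hsw : (∑ T, weight u T * g (T ∩ E)) * (∑ ω, weight wE ω) = (∑ ω, weight wE ω * g (ω ∩ E)) * ∑ T, weight u T := by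
    rw [Finset.sum_mul_sum, Finset.sum_mul_sum,
      ← Fintype.sum_prod_type' (fun T ω => weight u T * g (T ∩ E) * weight wE ω),
      ← Fintype.sum_prod_type' (fun ω T => weight wE ω * g (ω ∩ E) * weight u T)]
    refine Fintype.sum_bijective _ (swap_involutive Eᶜ).bijective _ _ (fun p => ?_)
    show weight u p.1 * g (p.1 ∩ E) * weight wE p.2 = weight wE (Eᶜ.ite p.2 p.1) * g (Eᶜ.ite p.2 p.1 ∩ E) * weight u (Eᶜ.ite p.1 p.2)
    have hg : Eᶜ.ite p.2 p.1 ∩ E = p.1 ∩ E := by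
      ext e; by_cases heE : e ∈ E <;> simp [Set.ite, heE]
    have hw := weight_swap₂ u wE Eᶜ (fun e he => by
      have heE : e ∈ E := not_not.1 (fun h => he h)
      simp [hu, hwE, heE]) p.1 p.2
    rw [hg, mul_right_comm, hw]; ring
  rw [IndepCopies.sum_weight_eq_one, IndepCopies.sum_weight_eq_one, mul_one, mul_one] at hsw
  rw [ha, ← hsw, Finset.mul_sum]
  exact Finset.sum_congr rfl fun T _ => by rw [weight_half]

/-- The complement involution: `Σ_T g (Tᶜ ∩ E) = Σ_T g (T ∩ E)`. [folklore] -/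
theorem sum_compl_inter (E : Set ι) (g : Set ι → ℝ) : ∑ T : Set ι, g (Tᶜ ∩ E) = ∑ T : Set ι, g (T ∩ E) :=
  Fintype.sum_equiv (Function.Involutive.toPerm (compl : Set ι → Set ι) compl_involutive)
    (fun T => g (Tᶜ ∩ E)) (fun T => g (T ∩ E)) (fun _ => rfl)

end Lattice

/-! ### Vertex clusters: monotonicity, closedness, locality -/

section Graph

variable {V : Type*}

/-- The vertex cluster is closed under open adjacency. [folklore] -/
theorem mem_cluster_of_adj {ω : Set (Sym2 V)} {a u w : V} (hu : u ∈ openCluster ω a) (huw : (openGraph ω).Adj u w) :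
    w ∈ openCluster ω a :=
  SimpleGraph.Reachable.trans hu huw.reachable

/-- Symmetry of membership in vertex clusters. [folklore] -/
theorem mem_cluster_comm {ω : Set (Sym2 V)} {a b : V} : a ∈ openCluster ω b ↔ b ∈ openCluster ω a :=
  ⟨fun h => SimpleGraph.Reachable.symm h, fun h => SimpleGraph.Reachable.symm h⟩

/-- **Locality of `{C_z = S}` for vertex clusters**: two configurations agreeing on the pairs meeting `S` have `C_z = S` together.
[cite: VandenbergHaggstromKahn2005, §1 p. 8 (conditioning on `{C_s = W}`)] -/
theorem cluster_eq_of_agree {β β' : Set (Sym2 V)} {z : V} {S : Set V}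
    (hag : ∀ e : Sym2 V, (∃ v ∈ e, v ∈ S) → (e ∈ β ↔ e ∈ β')) (hS : openCluster β z = S) : openCluster β' z = S := by
  have h1 : ∀ v, (openGraph β').Reachable z v → (openGraph β).Reachable z v := by
    intro v hv
    rw [SimpleGraph.reachable_iff_reflTransGen] at hv
    induction hv with
    | refl => exact SimpleGraph.Reachable.refl z
    | @tail b c _ hbc ih =>
      obtain ⟨hβ', hne⟩ := (openGraph_adj β' b c).1 hbc
      have hb : b ∈ S := by rw [← hS]; exact ih
      exact ih.trans (SimpleGraph.Adj.reachable ((openGraph_adj β b c).2 ⟨(hag _ ⟨b, Sym2.mem_mk_left b c, hb⟩).2 hβ', hne⟩))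
  have h2 : ∀ v, (openGraph β).Reachable z v → (openGraph β').Reachable z v := by
    intro v hv
    rw [SimpleGraph.reachable_iff_reflTransGen] at hv
    induction hv with
    | refl => exact SimpleGraph.Reachable.refl z
    | @tail b c hab hbc ih =>
      obtain ⟨hβ, hne⟩ := (openGraph_adj β b c).1 hbc
      have hb' : (openGraph β).Reachable z b := (SimpleGraph.reachable_iff_reflTransGen z b).2 hab
      have hb : b ∈ S := by rw [← hS]; exact hb'
      exact ih.trans (SimpleGraph.Adj.reachable ((openGraph_adj β' b c).2 ⟨(hag _ ⟨b, Sym2.mem_mk_left b c, hb⟩).1 hβ, hne⟩))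
  rw [← hS]
  ext v
  exact ⟨h1 v, h2 v⟩

variable (E : Set (Sym2 V)) (s z : V)

/-- **Cylinder property**: `{C_z^{blue} = S}` is determined by the colours of the pairs meeting `S`. [this work] -/
theorem fibre_iff (T : Set (Sym2 V)) (S : Set V) :
    openCluster (Tᶜ ∩ E) z = S ↔ openCluster ((T ∩ {e : Sym2 V | ∃ v ∈ e, v ∈ S})ᶜ ∩ E) z = S := by
  have hag : ∀ e : Sym2 V, (∃ v ∈ e, v ∈ S) → (e ∈ Tᶜ ∩ E ↔ e ∈ (T ∩ {e : Sym2 V | ∃ v ∈ e, v ∈ S})ᶜ ∩ E) := by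
    intro e he
    constructor
    · rintro ⟨hT, hE⟩
      exact ⟨fun h => hT h.1, hE⟩
    · rintro ⟨hTM, hE⟩
      exact ⟨fun hT => hTM ⟨hT, he⟩, hE⟩
  exact ⟨fun h => cluster_eq_of_agree hag h, fun h => cluster_eq_of_agree (fun e he => (hag e he).symm) h⟩

/-- **Fibre identity, blue side**: on `{C_z^{blue} = S}` with `s ∉ S`, recolouring red every pair meeting `S` does not change the blue cluster
of `s` (a blue path from `s` cannot enter `S`). [this work] -/
theorem fibre_blue {T : Set (Sym2 V)} {S : Set V} (hS : openCluster (Tᶜ ∩ E) z = S) (hs : s ∉ S) :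
    openCluster ((T ∪ {e : Sym2 V | ∃ v ∈ e, v ∈ S})ᶜ ∩ E) s = openCluster (Tᶜ ∩ E) s := by
  set M : Set (Sym2 V) := {e | ∃ v ∈ e, v ∈ S} with hM
  have hsub : (T ∪ M)ᶜ ∩ E ⊆ Tᶜ ∩ E :=
    Set.inter_subset_inter_left E (Set.compl_subset_compl.2 Set.subset_union_left)
  apply Set.Subset.antisymm (Freeze.openCluster_mono hsub s)
  refine Fan.cluster_subset_of_closed (mem_openCluster_self _ s) fun u w hu huw => ?_
  obtain ⟨⟨huwT, huwE⟩, hne⟩ := (openGraph_adj _ u w).1 huw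
  -- `u` and `w` are joined to `s` by blue paths, hence lie outside `S`
  have hu' : u ∈ openCluster (Tᶜ ∩ E) s := Freeze.openCluster_mono hsub s hu
  have hw' : w ∈ openCluster (Tᶜ ∩ E) s := mem_cluster_of_adj hu' huw
  have hout : ∀ v, v ∈ openCluster (Tᶜ ∩ E) s → v ∉ S := by
    intro v hv hvS
    rw [← hS] at hvS
    have h1 : (openGraph (Tᶜ ∩ E)).Reachable z s := SimpleGraph.Reachable.trans hvS (SimpleGraph.Reachable.symm hv)
    have h2 : s ∈ S := by rw [← hS]; exact h1
    exact hs h2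
  have hnotM : s(u, w) ∉ M := by
    rintro ⟨v, hv, hvS⟩
    rcases Sym2.mem_iff.1 hv with rfl | rfl
    · exact hout _ hu' hvS
    · exact hout _ hw' hvS
  exact mem_cluster_of_adj hu ((openGraph_adj _ u w).2 ⟨⟨fun h => h.elim huwT hnotM, huwE⟩, hne⟩)

/-- **Fibre identity, red side**: on `{C_z^{blue} = S}` with `s ∉ S` and every vertex of `S` adjacent to `s` (the cone hypothesis on the fibre),
recolouring red every pair meeting `S` does not change the red cluster of `s`. [this work] -/
theorem fibre_red {T : Set (Sym2 V)} {S : Set V} (hS : openCluster (Tᶜ ∩ E) z = S) (hs : s ∉ S)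
    (hcone : ∀ v ∈ S, s(s, v) ∈ E) :
    openCluster ((T ∪ {e : Sym2 V | ∃ v ∈ e, v ∈ S}) ∩ E) s = openCluster (T ∩ E) s := by
  set M : Set (Sym2 V) := {e | ∃ v ∈ e, v ∈ S} with hM
  apply Set.Subset.antisymm _ (Freeze.openCluster_mono (Set.inter_subset_inter_left E Set.subset_union_left) s)
  refine Fan.cluster_subset_of_closed (mem_openCluster_self _ s) fun u w hu huw => ?_
  obtain ⟨⟨huwTM, huwE⟩, hne⟩ := (openGraph_adj _ u w).1 huw
  by_cases hT : s(u, w) ∈ T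
  · exact mem_cluster_of_adj hu ((openGraph_adj _ u w).2 ⟨⟨hT, huwE⟩, hne⟩)
  · -- the pair is blue and meets `S`; then `w ∈ S`
    obtain ⟨v, hv, hvS⟩ := huwTM.resolve_left hT
    have hblue : (openGraph (Tᶜ ∩ E)).Adj u w := (openGraph_adj _ u w).2 ⟨⟨hT, huwE⟩, hne⟩
    have hwS : w ∈ S := by
      rcases Sym2.mem_iff.1 hv with rfl | rfl
      · rw [← hS] at hvS ⊢; exact mem_cluster_of_adj hvS hblue
      · exact hvS
    -- the spoke `s w` exists and is red (else `s` would be in the blue cluster of `z`)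
    have hsw : s ≠ w := fun h => hs (h ▸ hwS)
    have hspokeT : s(s, w) ∈ T := by
      by_contra h
      have hadj : (openGraph (Tᶜ ∩ E)).Adj w s := (openGraph_adj _ w s).2 ⟨⟨by rwa [Sym2.eq_swap], by rw [Sym2.eq_swap]; exact hcone w hwS⟩, hsw.symm⟩
      have : s ∈ openCluster (Tᶜ ∩ E) z := mem_cluster_of_adj (hS ▸ hwS : w ∈ openCluster (Tᶜ ∩ E) z) hadj
      exact hs (hS ▸ this)
    exact mem_cluster_of_adj (mem_openCluster_self _ s) ((openGraph_adj _ s w).2 ⟨⟨hspokeT, hcone w hwS⟩, hsw⟩)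

end Graph

/-! ### BHK Theorem 1.3 for the VERTEX cluster of percolation on `E`, uniform language -/

section Sums

variable {V : Type*} [Fintype V]

omit [Fintype V] in
/-- The vertex set `{z} ∪ V(C)` read off an edge set `C`; for `C = C_z` it is the vertex cluster. [folklore] -/
theorem vset_openEdgeCluster (ω : Set (Sym2 V)) (z : V) :
    {v : V | v = z ∨ ∃ e ∈ openEdgeCluster ω z, v ∈ e} = openCluster ω z := by
  ext v
  rw [Set.mem_setOf_eq, ← reachable_iff_exists_mem_openEdgeCluster]
  rfl

/-- **BHK Thm 1.3 for the blue vertex cluster of `z` given `s ∉` it, percolation on `E`, uniform sums**: for monotone `a₁, a₂ : Set V → ℝ`,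
`(Σ_{T : s ∉ B T} a₁ (B T)) (Σ_{T : s ∉ B T} a₂ (B T)) ≤ #{T : s ∉ B T} · Σ_{T : s ∉ B T} a₁ (B T) a₂ (B T)`, `B T = openCluster (Tᶜ ∩ E) z`.
[cite: VandenbergHaggstromKahn2005, Thm. 1.3 (p. 6)] -/
theorem bhk_vertex (E : Set (Sym2 V)) (s z : V) {a₁ a₂ : Set V → ℝ} (ha₁ : Monotone a₁) (ha₂ : Monotone a₂) :
    (∑ T : Set (Sym2 V), if s ∉ openCluster (Tᶜ ∩ E) z then a₁ (openCluster (Tᶜ ∩ E) z) else 0) *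
      (∑ T : Set (Sym2 V), if s ∉ openCluster (Tᶜ ∩ E) z then a₂ (openCluster (Tᶜ ∩ E) z) else 0) ≤
    (∑ T : Set (Sym2 V), if s ∉ openCluster (Tᶜ ∩ E) z then (1 : ℝ) else 0) *
      ∑ T : Set (Sym2 V), if s ∉ openCluster (Tᶜ ∩ E) z then a₁ (openCluster (Tᶜ ∩ E) z) * a₂ (openCluster (Tᶜ ∩ E) z) else 0 := by
  -- the blue sums as red sums
  rw [sum_compl_inter E (fun β => if s ∉ openCluster β z then a₁ (openCluster β z) else 0),
    sum_compl_inter E (fun β => if s ∉ openCluster β z then a₂ (openCluster β z) else 0),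
    sum_compl_inter E (fun β => if s ∉ openCluster β z then (1 : ℝ) else 0),
    sum_compl_inter E (fun β => if s ∉ openCluster β z then a₁ (openCluster β z) * a₂ (openCluster β z) else 0)]
  -- BHK Thm 1.3 in weighted form, weights `½·1_E`
  set wE : Sym2 V → ℝ := fun e => if e ∈ E then (1 / 2 : ℝ) else 0 with hwE
  have hw0 : ∀ e, 0 ≤ wE e := fun e => by simp only [hwE]; split_ifs <;> norm_num
  have hw1 : ∀ e, wE e ≤ 1 := fun e => by simp only [hwE]; split_ifs <;> norm_num
  have hm : ∑ ω, weight wE ω = 1 := IndepCopies.sum_weight_eq_one wE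
  let vs : Set (Sym2 V) → Set V := fun c => {v : V | v = z ∨ ∃ e ∈ c, v ∈ e}
  have hvs : Monotone vs := fun c c' h v hv => hv.imp id fun ⟨e, he, hve⟩ => ⟨e, h he, hve⟩
  have key := IndepCopies.bhk_pa (s := z) hw0 hw1 hm ({s} : Set V) (F := fun c => a₁ (vs c)) (G := fun c => a₂ (vs c))
    (fun c c' h => ha₁ (hvs h)) (fun c c' h => ha₂ (hvs h))
  -- identify the restricted quantities
  have hE : ∀ ω : Set (Sym2 V), ω ∩ edgesIn (Finset.univ : Finset V) = ω := fun ω => by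
    ext e
    simp only [Set.mem_inter_iff, edgesIn, Set.mem_setOf_eq, Finset.mem_univ, imp_true_iff, and_true]
  have hC : ∀ ω, vs (rC Finset.univ z ω) = openCluster ω z := fun ω => by
    show {v : V | v = z ∨ ∃ e ∈ openEdgeCluster (ω ∩ edgesIn Finset.univ) z, v ∈ e} = openCluster ω z
    rw [hE, vset_openEdgeCluster]
  have hD : ∀ ω, ind (rD Finset.univ z ({s} : Set V)) ω = if s ∉ openCluster ω z then (1 : ℝ) else 0 := fun ω => by
    have : ω ∈ rD Finset.univ z ({s} : Set V) ↔ s ∉ openCluster ω z := by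
      simp only [rD, hE, Set.mem_setOf_eq, Set.mem_singleton_iff, forall_eq]; rfl
    by_cases h : s ∉ openCluster ω z
    · rw [ind_of_mem (this.2 h), if_pos h]
    · rw [ind_of_not_mem (fun h' => h (this.1 h')), if_neg h]
  have s1 : ∑ ω, weight wE ω * (a₁ (vs (rC Finset.univ z ω)) * ind (rD Finset.univ z ({s} : Set V)) ω) =
      ∑ ω, weight wE ω * (if s ∉ openCluster ω z then a₁ (openCluster ω z) else 0) :=
    Finset.sum_congr rfl fun ω _ => by rw [hC, hD]; split_ifs <;> simp
  have s2 : ∑ ω, weight wE ω * (a₂ (vs (rC Finset.univ z ω)) * ind (rD Finset.univ z ({s} : Set V)) ω) =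
      ∑ ω, weight wE ω * (if s ∉ openCluster ω z then a₂ (openCluster ω z) else 0) :=
    Finset.sum_congr rfl fun ω _ => by rw [hC, hD]; split_ifs <;> simp
  have s3 : ∑ ω, weight wE ω * (a₁ (vs (rC Finset.univ z ω)) * a₂ (vs (rC Finset.univ z ω)) * ind (rD Finset.univ z ({s} : Set V)) ω) =
      ∑ ω, weight wE ω * (if s ∉ openCluster ω z then a₁ (openCluster ω z) * a₂ (openCluster ω z) else 0) :=
    Finset.sum_congr rfl fun ω _ => by rw [hC, hD]; split_ifs <;> simp
  have s4 : ∑ ω, weight wE ω * ind (rD Finset.univ z ({s} : Set V)) ω = ∑ ω, weight wE ω * (if s ∉ openCluster ω z then (1 : ℝ) else 0) :=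
    Finset.sum_congr rfl fun ω _ => by rw [hD]
  rw [s1, s2, s3, s4] at key
  -- change of weights
  rw [sum_weight_indicator E (fun ω => if s ∉ openCluster ω z then a₁ (openCluster ω z) else 0),
    sum_weight_indicator E (fun ω => if s ∉ openCluster ω z then a₂ (openCluster ω z) else 0),
    sum_weight_indicator E (fun ω => if s ∉ openCluster ω z then a₁ (openCluster ω z) * a₂ (openCluster ω z) else 0),
    sum_weight_indicator E (fun ω => if s ∉ openCluster ω z then (1 : ℝ) else 0)] at key
  have hc : (0 : ℝ) < (1 / 2 : ℝ) ^ Fintype.card (Sym2 V) := pow_pos (by norm_num) _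
  have aux : ∀ {c A₁ A₂ A₁₂ P : ℝ}, 0 < c → c * A₁ * (c * A₂) ≤ c * A₁₂ * (c * P) → A₁ * A₂ ≤ P * A₁₂ := by
    intro c A₁ A₂ A₁₂ P hc h
    nlinarith [h, mul_pos hc hc]
  exact aux hc key

end Sums

end Cone

end TwoStage

end Antithetic

end Summit.CriticalPhenomena.PercolationContinuityZ3.Theorems
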